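import Literature.NumberTheory.Sieve.Maynard2016Prop92QuadFormSwap
import HarnessLib

/-!
# Maynard 2016, Proposition 9.2 for `𝒜 = ℤ` — the local sums `T^{(m)}(r,s)` (display (9.12))

Sources: J. Maynard, *Dense clusters of primes in subsets*, Compositio Math. 152 (2016) 1517–1554 =
arXiv:1405.2593 [Maynard2016DenseClusters], proof of Proposition 9.2, pp. 21–22 (displays
(9.11)–(9.13)); proof of Proposition 9.1 p. 19 (display (9.5), the model computation).

Steps (V) and (P) of the exact-algebra leaf `Maynard2016Prop92Regroup` (M1): the `φ_L`-twisted
twins of `FGKMT2018LocalPairSumVanishing` / `FGKMT2018LocalPairSumPeel` for the inner sum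
`T^{(m)}(r,s) = ∑'_{d ∣ r, e ∣ s} μ(d)μ(e) φ_L(d)φ_L(e)/φ_L([d,e])` (`localPairSumM`) of (9.11).
«The presence of `φ_L` slightly changes the value of `S_p`»: by the multiplicativity
`φ_L(p N) = φ_L(p) φ_L(N)` (`totForm_mul_of_coprime`),

* `pairTermM_update_mul_left/right/both/…_of_ne` — scaling one coordinate by a prime `p`
  multiplies the summand by `−1`, `−1`, `φ_L(p)` resp. kills it;
* `localPairSumM_eq_zero_of_prod_ne` — **`S_p^{(m)} = 0` if `p` divides one of `r, s` but not the
  other**, so `T^{(m)}(r,s) = 0` unless `∏ rᵢ = ∏ sᵢ`;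
* `localPairSumM_peel` — (9.5)-type peeling: `T^{(m)}(r,s) = S_p^{(m)} · T^{(m)}(r/p@j, s/p@j')` with
  **`S_p^{(m)} = φ_L(p) − 1` if `p ∣ (r_j, s_j)` (same index; `= p − 2` for `p ∤ a_m`) and
  `S_p^{(m)} = −1` if `p ∣ r_j, p ∣ s_{j'}`, `j ≠ j'`** (display (9.12));
* `localPairSumM_eq_prod_localFactorM` — for `∏ rᵢ = ∏ sᵢ`: `T^{(m)}(r,s) = ∏_{p ∣ ∏r} S_p^{(m)}(r,s)`.

## References
* J. Maynard, *Dense clusters of primes in subsets*, Compositio Math. 152 (2016), proof of Prop. 9.2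
  pp. 21–22, (9.11)–(9.13); proof of Prop. 9.1 p. 19, (9.5) [Maynard2016DenseClusters].
* K. Ford, B. Green, S. Konyagin, J. Maynard, T. Tao, *Long gaps between primes*, JAMS 31 (2018),
  Thm 6 (7.13) [FordGreenKonyaginMaynardTao2018].
-/

noncomputable section

open Finset
open scoped ArithmeticFunction.Moebius

namespace Literature.NumberTheory.Sieve.FGKMT2018

variable {k : ℕ}

/-! ### The summand and its symmetry -/

/-- The summand of `T^{(m)}(r,s)`: `μ(d)μ(e) φ_L(d)φ_L(e)/φ_L(∏ᵢ[dᵢ,eᵢ])` on cross-coprime pairs,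
`0` otherwise. [cite: Maynard2016DenseClusters, proof of Prop. 9.2 p. 21, (9.11)] -/
def pairTermM (L : Fin k → ℤ × ℤ) (m : Fin k) (d e : Fin k → ℕ) : ℝ :=
  if ∀ i j, i ≠ j → (d i * e i).Coprime (d j * e j) then
    ((μ (∏ i, d i) : ℤ) : ℝ) * ((μ (∏ i, e i) : ℤ) : ℝ) *
        (totForm (L m) (∏ i, d i) * totForm (L m) (∏ i, e i)) /
      totForm (L m) (∏ i, Nat.lcm (d i) (e i))
  else 0

/-- For `r ∈ dkBoxP` the divisor filters of `dkBoxP` and `dkBox` agree (both are `∏ᵢ divisors(rᵢ)`).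
[cite: Maynard2016DenseClusters, proof of Prop. 9.2 p. 21, (9.10)–(9.11)] -/
theorem filter_dvd_dkBoxP_eq_filter_dvd_dkBox {L : Fin k → ℤ × ℤ} {B : ℕ} {R : ℝ} {m : Fin k}
    {r : Fin k → ℕ} (hr : r ∈ dkBoxP L B R m) :
    (dkBoxP L B R m).filter (fun d => ∀ i, d i ∣ r i) =
      (dkBox L B R).filter (fun d => ∀ i, d i ∣ r i) := by
  rw [filter_dvd_dkBoxP_eq_piFinset_divisors hr,
    filter_dvd_eq_piFinset_divisors (dkBoxP_subset L B R m hr)]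

/-- `T^{(m)}(r,s) = ∑_{d ∣ r} ∑_{e ∣ s} pairTermM d e` over the `dkBox` divisor filters
(`r, s ∈ dkBoxP`). [cite: Maynard2016DenseClusters, proof of Prop. 9.2 p. 21, (9.11)] -/
theorem localPairSumM_eq_sum_pairTermM {L : Fin k → ℤ × ℤ} {B : ℕ} {R : ℝ} {m : Fin k}
    {r s : Fin k → ℕ} (hr : r ∈ dkBoxP L B R m) (hs : s ∈ dkBoxP L B R m) :
    localPairSumM L B R m r s = ∑ d ∈ (dkBox L B R).filter (fun d => ∀ i, d i ∣ r i),
      ∑ e ∈ (dkBox L B R).filter (fun e => ∀ i, e i ∣ s i), pairTermM L m d e := by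
  unfold localPairSumM pairTermM
  rw [filter_dvd_dkBoxP_eq_filter_dvd_dkBox hr, filter_dvd_dkBoxP_eq_filter_dvd_dkBox hs]

/-- `pairTermM d e = pairTermM e d`. [cite: Maynard2016DenseClusters, proof of Prop. 9.2 p. 21, (9.11)] -/
theorem pairTermM_comm (L : Fin k → ℤ × ℤ) (m : Fin k) (d e : Fin k → ℕ) :
    pairTermM L m d e = pairTermM L m e d := by
  unfold pairTermM
  by_cases h : ∀ i l, i ≠ l → (d i * e i).Coprime (d l * e l)
  · rw [if_pos h, if_pos ((cross_comm d e).1 h)]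
    simp only [Nat.lcm_comm (d _) (e _)]
    ring
  · rw [if_neg h, if_neg (fun h' => h ((cross_comm d e).2 h'))]

/-- `T^{(m)}(r,s) = T^{(m)}(s,r)`. [cite: Maynard2016DenseClusters, proof of Prop. 9.2 p. 21, (9.11)] -/
theorem localPairSumM_comm (L : Fin k → ℤ × ℤ) (B : ℕ) (R : ℝ) (m : Fin k) (r s : Fin k → ℕ) :
    localPairSumM L B R m r s = localPairSumM L B R m s r := by
  classical
  unfold localPairSumM
  rw [Finset.sum_comm]
  refine Finset.sum_congr rfl fun e _ => Finset.sum_congr rfl fun d _ => ?_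
  exact pairTermM_comm L m d e

/-- `φ_L(1) = 1`. [cite: Maynard2016DenseClusters, §6 p. 11 (φ_L)] -/
theorem totForm_one (l : ℤ × ℤ) (hl : l.1 ≠ 0) : totForm l 1 = 1 := by
  unfold totForm
  have h : (Nat.totient l.1.natAbs : ℝ) ≠ 0 := by
    exact_mod_cast (Nat.totient_pos.2 (Int.natAbs_pos.2 hl)).ne'
  rw [mul_one, div_self h]

/-- `pairTermM 1 1 = 1`. [cite: Maynard2016DenseClusters, proof of Prop. 9.2 p. 21, (9.11)] -/
theorem pairTermM_one_one (L : Fin k → ℤ × ℤ) (m : Fin k) (hl : (L m).1 ≠ 0) :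
    pairTermM L m (fun _ : Fin k => 1) (fun _ => 1) = 1 := by
  unfold pairTermM
  rw [if_pos (fun i l _ => by simp)]
  simp [totForm_one (L m) hl]

/-! ### Scaling of the summand at one prime («the presence of `φ_L`») -/

/-- `φ_L` of a vector product is nonzero-argument: `∏ dᵢ ≠ 0` if no `dᵢ` is divisible by `p`. [folklore] -/
private theorem prod_ne_zero_of_not_dvd {d : Fin k → ℕ} {p : ℕ} (hd : ∀ i, ¬ p ∣ d i) :
    (∏ i, d i) ≠ 0 :=
  Finset.prod_ne_zero_iff.2 fun i _ h0 => hd i (h0 ▸ dvd_zero p)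

/-- `∏ [dᵢ,eᵢ] ≠ 0` in `ℕ` if no `dᵢ, eᵢ` is divisible by `p`. [folklore] -/
private theorem prodLcm_ne_zero_of_not_dvd {d e : Fin k → ℕ} {p : ℕ} (hd : ∀ i, ¬ p ∣ d i)
    (he : ∀ i, ¬ p ∣ e i) : (∏ i, Nat.lcm (d i) (e i)) ≠ 0 := by
  refine Finset.prod_ne_zero_iff.2 fun i _ => ?_
  have h1 : d i ≠ 0 := fun h0 => hd i (by rw [h0]; exact dvd_zero p)
  have h2 : e i ≠ 0 := fun h0 => he i (by rw [h0]; exact dvd_zero p)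
  exact (Nat.lcm_pos (Nat.pos_of_ne_zero h1) (Nat.pos_of_ne_zero h2)).ne'

/-- `p` is coprime to `∏ [dᵢ,eᵢ]` if no `dᵢ, eᵢ` is divisible by the prime `p`. [folklore] -/
private theorem coprime_prodLcm_of_not_dvd {d e : Fin k → ℕ} {p : ℕ} (hp : p.Prime)
    (hd : ∀ i, ¬ p ∣ d i) (he : ∀ i, ¬ p ∣ e i) : p.Coprime (∏ i, Nat.lcm (d i) (e i)) := by
  refine Nat.Coprime.prod_right fun i _ => (Nat.Prime.coprime_iff_not_dvd hp).2 fun h => ?_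
  rcases (Nat.Prime.dvd_mul hp).1 (h.trans (Nat.lcm_dvd_mul (d i) (e i))) with h' | h'
  · exact hd i h'
  · exact he i h'

/-- **Scaling `dⱼ ↦ p dⱼ`** (`p ∤ d, e`): `μ` flips, `φ_L(d)` and `φ_L([d,e])` both gain the factor
`φ_L(p)`, so the summand changes sign. [cite: Maynard2016DenseClusters, proof of Prop. 9.2 p. 22, (9.12) («0 otherwise», «−1»)] -/
theorem pairTermM_update_mul_left (L : Fin k → ℤ × ℤ) (m : Fin k) (hl : (L m).1 ≠ 0)
    (d e : Fin k → ℕ) (j : Fin k) {p : ℕ} (hp : p.Prime) (hd : ∀ i, ¬ p ∣ d i)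
    (he : ∀ i, ¬ p ∣ e i) :
    pairTermM L m (Function.update d j (d j * p)) e = -pairTermM L m d e := by
  have hc := cross_update_mul_iff d e j hp (fun l _ => hd l) (fun l _ => he l)
  have hd0 := prod_ne_zero_of_not_dvd hd
  have hΛ0 := prodLcm_ne_zero_of_not_dvd hd he
  have hpd : p.Coprime (∏ i, d i) :=
    Nat.Coprime.prod_right fun i _ => (Nat.Prime.coprime_iff_not_dvd hp).2 (hd i)
  have hpΛ := coprime_prodLcm_of_not_dvd hp hd he
  have hD : totForm (L m) (∏ i, Function.update d j (d j * p) i) =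
      totForm (L m) p * totForm (L m) (∏ i, d i) := by
    rw [prod_update_mul, totForm_mul_of_coprime (L m) hl hp.ne_zero hd0 hpd]
  have hL : totForm (L m) (∏ i, Nat.lcm (Function.update d j (d j * p) i) (e i)) =
      totForm (L m) p * totForm (L m) (∏ i, Nat.lcm (d i) (e i)) := by
    rw [prod_lcm_update_mul d e j hp (he j), totForm_mul_of_coprime (L m) hl hp.ne_zero hΛ0 hpΛ]
  have hφp : totForm (L m) p ≠ 0 := (totForm_pos (L m) hl hp.ne_zero).ne'
  have hφΛ : totForm (L m) (∏ i, Nat.lcm (d i) (e i)) ≠ 0 := (totForm_pos (L m) hl hΛ0).ne'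
  unfold pairTermM
  by_cases hcr : ∀ i l, i ≠ l → (d i * e i).Coprime (d l * e l)
  · rw [if_pos hcr, if_pos (hc.2 hcr), moebius_prod_update_mul d j hp hd, hD, hL]
    push_cast
    field_simp
  · rw [if_neg hcr, if_neg (fun h => hcr (hc.1 h)), neg_zero]

/-- Scaling `eⱼ ↦ p eⱼ`: the summand changes sign. [cite: Maynard2016DenseClusters, proof of Prop. 9.2 p. 22, (9.12)] -/
theorem pairTermM_update_mul_right (L : Fin k → ℤ × ℤ) (m : Fin k) (hl : (L m).1 ≠ 0)
    (d e : Fin k → ℕ) (j : Fin k) {p : ℕ} (hp : p.Prime) (hd : ∀ i, ¬ p ∣ d i)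
    (he : ∀ i, ¬ p ∣ e i) :
    pairTermM L m d (Function.update e j (e j * p)) = -pairTermM L m d e := by
  rw [pairTermM_comm, pairTermM_update_mul_left L m hl e d j hp he hd, pairTermM_comm]

/-- **Scaling `(dⱼ, eⱼ) ↦ (p dⱼ, p eⱼ)`** (same coordinate): the summand gains
`φ_L(p)²/φ_L(p) = φ_L(p)` (the `S_p^{(m)} = φ_L(p) − 1` case). [cite: Maynard2016DenseClusters, proof of Prop. 9.2 p. 22, (9.12) («p − 2 if p ∣ (r,s)»)] -/
theorem pairTermM_update_mul_both (L : Fin k → ℤ × ℤ) (m : Fin k) (hl : (L m).1 ≠ 0)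
    (d e : Fin k → ℕ) (j : Fin k) {p : ℕ} (hp : p.Prime) (hd : ∀ i, ¬ p ∣ d i)
    (he : ∀ i, ¬ p ∣ e i) :
    pairTermM L m (Function.update d j (d j * p)) (Function.update e j (e j * p)) =
      totForm (L m) p * pairTermM L m d e := by
  -- cross invariance in two steps
  have hc1 := cross_update_mul_iff d (Function.update e j (e j * p)) j hp (fun l _ => hd l)
    (fun l hl' => by rw [Function.update_of_ne hl']; exact he l)
  have hc2 := cross_update_mul_iff e d j hp (fun l _ => he l) (fun l _ => hd l)
  have hc : (∀ i l, i ≠ l → (Function.update d j (d j * p) i * Function.update e j (e j * p) i).Coprime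
      (Function.update d j (d j * p) l * Function.update e j (e j * p) l)) ↔
      ∀ i l, i ≠ l → (d i * e i).Coprime (d l * e l) := by
    rw [hc1, cross_comm, hc2, cross_comm]
  have hd0 := prod_ne_zero_of_not_dvd hd
  have he0 := prod_ne_zero_of_not_dvd he
  have hΛ0 := prodLcm_ne_zero_of_not_dvd hd he
  have hpd : p.Coprime (∏ i, d i) :=
    Nat.Coprime.prod_right fun i _ => (Nat.Prime.coprime_iff_not_dvd hp).2 (hd i)
  have hpe : p.Coprime (∏ i, e i) :=
    Nat.Coprime.prod_right fun i _ => (Nat.Prime.coprime_iff_not_dvd hp).2 (he i)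
  have hpΛ := coprime_prodLcm_of_not_dvd hp hd he
  have hD : totForm (L m) (∏ i, Function.update d j (d j * p) i) =
      totForm (L m) p * totForm (L m) (∏ i, d i) := by
    rw [prod_update_mul, totForm_mul_of_coprime (L m) hl hp.ne_zero hd0 hpd]
  have hE : totForm (L m) (∏ i, Function.update e j (e j * p) i) =
      totForm (L m) p * totForm (L m) (∏ i, e i) := by
    rw [prod_update_mul, totForm_mul_of_coprime (L m) hl hp.ne_zero he0 hpe]
  have hL : totForm (L m) (∏ i, Nat.lcm (Function.update d j (d j * p) i)
      (Function.update e j (e j * p) i)) =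
      totForm (L m) p * totForm (L m) (∏ i, Nat.lcm (d i) (e i)) := by
    rw [prod_lcm_update_mul_update_mul d e j p, totForm_mul_of_coprime (L m) hl hp.ne_zero hΛ0 hpΛ]
  have hφp : totForm (L m) p ≠ 0 := (totForm_pos (L m) hl hp.ne_zero).ne'
  have hφΛ : totForm (L m) (∏ i, Nat.lcm (d i) (e i)) ≠ 0 := (totForm_pos (L m) hl hΛ0).ne'
  unfold pairTermM
  by_cases hcr : ∀ i l, i ≠ l → (d i * e i).Coprime (d l * e l)
  · rw [if_pos hcr, if_pos (hc.2 hcr), moebius_prod_update_mul d j hp hd,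
      moebius_prod_update_mul e j hp he, hD, hE, hL]
    push_cast
    field_simp
  · rw [if_neg hcr, if_neg (fun h => hcr (hc.1 h)), mul_zero]

/-- Scaling `(dⱼ, e_{j'}) ↦ (p dⱼ, p e_{j'})` with `j ≠ j'` kills the summand (not cross-coprime).
[cite: Maynard2016DenseClusters, proof of Prop. 9.2 p. 22, (9.12) («−1 if p∣r, p∣s, p∤(r,s)»)] -/
theorem pairTermM_update_mul_update_mul_of_ne (L : Fin k → ℤ × ℤ) (m : Fin k) (d e : Fin k → ℕ)
    {j j' : Fin k} (hjj' : j ≠ j') {p : ℕ} (hp : p.Prime) :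
    pairTermM L m (Function.update d j (d j * p)) (Function.update e j' (e j' * p)) = 0 := by
  unfold pairTermM
  rw [if_neg]
  intro h
  have h1 := h j j' hjj'
  rw [Function.update_self, Function.update_self, Function.update_of_ne hjj',
    Function.update_of_ne (Ne.symm hjj')] at h1
  exact Nat.not_coprime_of_dvd_of_dvd hp.one_lt
    ((dvd_mul_left p (d j)).mul_right _) ((dvd_mul_left p (e j')).mul_left _) h1

/-! ### `dkBoxP` under removing a prime -/

/-- `r/p@j ∈ dkBoxP` for `r ∈ dkBoxP`, `p ∣ rⱼ`. [cite: Maynard2016DenseClusters, proof of Prop. 9.2 p. 21 (𝒟'_k divisor-closed)] -/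
theorem update_div_mem_dkBoxP {L : Fin k → ℤ × ℤ} {B : ℕ} {R : ℝ} {m : Fin k} {r : Fin k → ℕ}
    (hr : r ∈ dkBoxP L B R m) (j : Fin k) {p : ℕ} (hpj : p ∣ r j) :
    Function.update r j (r j / p) ∈ dkBoxP L B R m := by
  refine mem_dkBoxP_of_dvd hr fun i => ?_
  by_cases hi : i = j
  · subst hi; rw [Function.update_self]; exact Nat.div_dvd_of_dvd hpj
  · rw [Function.update_of_ne hi]

/-! ### (V) `T^{(m)}(r,s) = 0` unless `∏ rᵢ = ∏ sᵢ` -/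

/-- **`T^{(m)}(r,s) = 0` if a prime divides `∏rᵢ` but not `∏sᵢ`** (`r, s ∈ dkBoxP`): pairing
`d ↔ d·p@j` in the `d`-sum. [cite: Maynard2016DenseClusters, proof of Prop. 9.2 p. 22, (9.12)–(9.13) («S_p = 0 otherwise», «T^{(m)}_{r,s} = 0 unless r = s»)] -/
theorem localPairSumM_eq_zero_of_dvd_of_not_dvd {L : Fin k → ℤ × ℤ} {B : ℕ} {R : ℝ} {m : Fin k}
    (hl : (L m).1 ≠ 0) {r s : Fin k → ℕ} (hr : r ∈ dkBoxP L B R m) (hs : s ∈ dkBoxP L B R m)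
    {p : ℕ} (hp : p.Prime) (hpr : p ∣ ∏ i, r i) (hps : ¬ p ∣ ∏ i, s i) :
    localPairSumM L B R m r s = 0 := by
  classical
  have hrbox := dkBoxP_subset L B R m hr
  obtain ⟨j, -, hpj⟩ := ((Nat.prime_iff.1 hp).dvd_finsetProd_iff _).1 hpr
  rw [localPairSumM_eq_sum_pairTermM hr hs, sum_filter_dvd_eq_sum_add hrbox hp hpj]
  refine Finset.sum_eq_zero fun d hd => ?_
  have hd' : ∀ i, ¬ p ∣ d i := not_dvd_of_dvd_update_div hrbox hp hpj (Finset.mem_filter.1 hd).2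
  rw [← Finset.sum_add_distrib]
  refine Finset.sum_eq_zero fun e he => ?_
  have he' : ∀ i, ¬ p ∣ e i := fun i h =>
    hps ((h.trans ((Finset.mem_filter.1 he).2 i)).trans (Finset.dvd_prod_of_mem _ (Finset.mem_univ i)))
  rw [pairTermM_update_mul_left L m hl d e j hp hd' he', add_neg_cancel]

/-- `T^{(m)}(r,s) = 0` if a prime divides `∏sᵢ` but not `∏rᵢ`. [cite: Maynard2016DenseClusters, proof of Prop. 9.2 p. 22, (9.12)–(9.13)] -/
theorem localPairSumM_eq_zero_of_not_dvd_of_dvd {L : Fin k → ℤ × ℤ} {B : ℕ} {R : ℝ} {m : Fin k}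
    (hl : (L m).1 ≠ 0) {r s : Fin k → ℕ} (hr : r ∈ dkBoxP L B R m) (hs : s ∈ dkBoxP L B R m)
    {p : ℕ} (hp : p.Prime) (hpr : ¬ p ∣ ∏ i, r i) (hps : p ∣ ∏ i, s i) :
    localPairSumM L B R m r s = 0 := by
  rw [localPairSumM_comm]
  exact localPairSumM_eq_zero_of_dvd_of_not_dvd hl hs hr hp hps hpr

/-- **«`T^{(m)}_{r,s} = 0` unless `r = s`»** (as squarefree products): `T^{(m)}(r,s) = 0` unless
`∏rᵢ = ∏sᵢ` (`r, s ∈ dkBoxP`). [cite: Maynard2016DenseClusters, proof of Prop. 9.2 p. 22, after (9.12)] -/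
theorem localPairSumM_eq_zero_of_prod_ne {L : Fin k → ℤ × ℤ} {B : ℕ} {R : ℝ} {m : Fin k}
    (hl : (L m).1 ≠ 0) {r s : Fin k → ℕ} (hr : r ∈ dkBoxP L B R m) (hs : s ∈ dkBoxP L B R m)
    (hne : (∏ i, r i) ≠ ∏ i, s i) : localPairSumM L B R m r s = 0 := by
  have h := (Nat.Squarefree.ext_iff (squarefree_of_mem_dkBox (dkBoxP_subset L B R m hr))
    (squarefree_of_mem_dkBox (dkBoxP_subset L B R m hs))).not.1 hne
  obtain ⟨p, hp'⟩ := not_forall.1 h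
  obtain ⟨hp, hiff⟩ := Classical.not_imp.1 hp'
  by_cases hpr : p ∣ ∏ i, r i
  · exact localPairSumM_eq_zero_of_dvd_of_not_dvd hl hr hs hp hpr
      (fun hps => hiff ⟨fun _ => hps, fun _ => hpr⟩)
  · refine localPairSumM_eq_zero_of_not_dvd_of_dvd hl hr hs hp hpr ?_
    by_contra hps
    exact hiff ⟨fun h => absurd h hpr, fun h => absurd h hps⟩

/-! ### (P) Peeling one prime: `T^{(m)}(r,s) = S_p^{(m)} · T^{(m)}(r/p, s/p)` -/

/-- **(9.12), one prime at a time.** For `r, s ∈ dkBoxP` and a prime `p` with `p ∣ rⱼ`, `p ∣ s_{j'}`: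
`T^{(m)}(r,s) = S_p^{(m)} · T^{(m)}(r/p@j, s/p@j')` with `S_p^{(m)} = φ_L(p) − 1` if `j = j'` and
`S_p^{(m)} = −1` if `j ≠ j'`. [cite: Maynard2016DenseClusters, proof of Prop. 9.2 p. 22, (9.12); proof of Prop. 9.1 p. 19, (9.5)] -/
theorem localPairSumM_peel {L : Fin k → ℤ × ℤ} {B : ℕ} {R : ℝ} {m : Fin k} (hl : (L m).1 ≠ 0)
    {r s : Fin k → ℕ} (hr : r ∈ dkBoxP L B R m) (hs : s ∈ dkBoxP L B R m) {p : ℕ} (hp : p.Prime)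
    {j j' : Fin k} (hpj : p ∣ r j) (hpj' : p ∣ s j') :
    localPairSumM L B R m r s = (if j = j' then totForm (L m) p - 1 else -1) *
      localPairSumM L B R m (Function.update r j (r j / p)) (Function.update s j' (s j' / p)) := by
  classical
  have hrbox := dkBoxP_subset L B R m hr
  have hsbox := dkBoxP_subset L B R m hs
  rw [localPairSumM_eq_sum_pairTermM hr hs,
    localPairSumM_eq_sum_pairTermM (update_div_mem_dkBoxP hr j hpj) (update_div_mem_dkBoxP hs j' hpj'),
    sum_filter_dvd_eq_sum_add hrbox hp hpj, Finset.mul_sum]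
  refine Finset.sum_congr rfl fun d hd => ?_
  have hd' : ∀ i, ¬ p ∣ d i := not_dvd_of_dvd_update_div hrbox hp hpj (Finset.mem_filter.1 hd).2
  rw [sum_filter_dvd_eq_sum_add hsbox hp hpj', sum_filter_dvd_eq_sum_add hsbox hp hpj',
    ← Finset.sum_add_distrib, Finset.mul_sum]
  refine Finset.sum_congr rfl fun e he => ?_
  have he' : ∀ i, ¬ p ∣ e i := not_dvd_of_dvd_update_div hsbox hp hpj' (Finset.mem_filter.1 he).2
  rw [pairTermM_update_mul_right L m hl d e j' hp hd' he', pairTermM_update_mul_left L m hl d e j hp hd' he']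
  by_cases hjj : j = j'
  · subst hjj
    rw [if_pos rfl, pairTermM_update_mul_both L m hl d e j hp hd' he']
    ring
  · rw [if_neg hjj, pairTermM_update_mul_update_mul_of_ne L m d e hjj hp]
    ring

/-! ### Iterating: `T^{(m)}(r,s) = ∏_{p ∣ r} S_p^{(m)}(r,s)` -/

/-- The local factor `S_p^{(m)}(r,s)` of (9.12) for `∏rᵢ = ∏sᵢ`: `φ_L(p) − 1` if `p ∣ (rⱼ, sⱼ)` for
some `j`, else `−1`. [cite: Maynard2016DenseClusters, proof of Prop. 9.2 p. 22, (9.12)] -/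
def localFactorM (L : Fin k → ℤ × ℤ) (m : Fin k) (r s : Fin k → ℕ) (p : ℕ) : ℝ :=
  if ∃ i, p ∣ r i ∧ p ∣ s i then totForm (L m) p - 1 else -1

/-- `T^{(m)}(1,1) = 1`. [cite: Maynard2016DenseClusters, proof of Prop. 9.2 p. 21, (9.11)] -/
theorem localPairSumM_one_one {L : Fin k → ℤ × ℤ} {B : ℕ} {R : ℝ} {m : Fin k} (hl : (L m).1 ≠ 0)
    (h1 : (fun _ : Fin k => (1 : ℕ)) ∈ dkBoxP L B R m) :
    localPairSumM L B R m (fun _ => 1) (fun _ => 1) = 1 := by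
  classical
  have hset : (dkBox L B R).filter (fun d => ∀ i, d i ∣ (fun _ : Fin k => (1 : ℕ)) i) =
      {fun _ => 1} := by
    ext d
    simp only [Finset.mem_filter, Finset.mem_singleton, Nat.dvd_one]
    constructor
    · rintro ⟨-, h⟩; exact funext h
    · rintro rfl; exact ⟨dkBoxP_subset L B R m h1, fun _ => rfl⟩
  rw [localPairSumM_eq_sum_pairTermM h1 h1, hset, Finset.sum_singleton, Finset.sum_singleton,
    pairTermM_one_one L m hl]

/-- **(9.12) iterated**: for `r, s ∈ dkBoxP` with `∏rᵢ = ∏sᵢ`, `T^{(m)}(r,s) = ∏_{p ∣ r} S_p^{(m)}(r,s)`.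
[cite: Maynard2016DenseClusters, proof of Prop. 9.2 p. 22, (9.12); proof of Prop. 9.1 p. 19, (9.5)] -/
theorem localPairSumM_eq_prod_localFactorM {L : Fin k → ℤ × ℤ} {B : ℕ} {R : ℝ} {m : Fin k}
    (hl : (L m).1 ≠ 0) {r s : Fin k → ℕ} (hr : r ∈ dkBoxP L B R m) (hs : s ∈ dkBoxP L B R m)
    (heq : (∏ i, r i) = ∏ i, s i) :
    localPairSumM L B R m r s = ∏ p ∈ (∏ i, r i).primeFactors, localFactorM L m r s p := by
  classical
  suffices h : ∀ N (r s : Fin k → ℕ), r ∈ dkBoxP L B R m → s ∈ dkBoxP L B R m →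
      (∏ i, r i) = N → (∏ i, s i) = N →
      localPairSumM L B R m r s = ∏ p ∈ N.primeFactors, localFactorM L m r s p from
    h _ r s hr hs rfl heq.symm
  intro N
  induction N using Nat.strong_induction_on with
  | _ N ih =>
    intro r s hr hs hrN hsN
    have hrbox := dkBoxP_subset L B R m hr
    have hsbox := dkBoxP_subset L B R m hs
    by_cases hN1 : N = 1
    · subst hN1
      have hr1 : r = fun _ => 1 := funext fun i => Nat.dvd_one.1 (by
        rw [← hrN]; exact Finset.dvd_prod_of_mem r (Finset.mem_univ i))
      have hs1 : s = fun _ => 1 := funext fun i => Nat.dvd_one.1 (by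
        rw [← hsN]; exact Finset.dvd_prod_of_mem s (Finset.mem_univ i))
      subst hr1 hs1
      rw [Nat.primeFactors_one, Finset.prod_empty, localPairSumM_one_one hl hr]
    · have hN0 : 0 < N := by
        rw [← hrN]; exact Finset.prod_pos fun i _ => one_le_of_mem_dkBox hrbox i
      have hp : N.minFac.Prime := Nat.minFac_prime hN1
      set p := N.minFac with hpdef
      have hpN : p ∣ N := Nat.minFac_dvd N
      have hpr : p ∣ ∏ i, r i := by rw [hrN]; exact hpN
      have hps : p ∣ ∏ i, s i := by rw [hsN]; exact hpN
      obtain ⟨j, -, hpj⟩ := ((Nat.prime_iff.1 hp).dvd_finsetProd_iff _).1 hpr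
      obtain ⟨j', -, hpj'⟩ := ((Nat.prime_iff.1 hp).dvd_finsetProd_iff _).1 hps
      rw [localPairSumM_peel hl hr hs hp hpj hpj']
      have hr' := update_div_mem_dkBoxP hr j hpj
      have hs' := update_div_mem_dkBoxP hs j' hpj'
      have hr'N : (∏ i, Function.update r j (r j / p) i) = N / p :=
        (Nat.div_eq_of_eq_mul_right hp.pos (by rw [mul_prod_update_div r j hpj, hrN])).symm
      have hs'N : (∏ i, Function.update s j' (s j' / p) i) = N / p :=
        (Nat.div_eq_of_eq_mul_right hp.pos (by rw [mul_prod_update_div s j' hpj', hsN])).symm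
      rw [ih (N / p) (Nat.div_lt_self hN0 hp.one_lt) _ _ hr' hs' hr'N hs'N,
        primeFactors_div_of_squarefree (hrN ▸ squarefree_of_mem_dkBox hrbox) hp hpN,
        ← Finset.mul_prod_erase N.primeFactors (localFactorM L m r s)
          (Nat.mem_primeFactors.2 ⟨hp, hpN, hN0.ne'⟩)]
      -- the local factor at `p`
      have hSp : localFactorM L m r s p = if j = j' then totForm (L m) p - 1 else -1 := by
        unfold localFactorM
        by_cases hjj : j = j'
        · subst hjj; rw [if_pos ⟨j, hpj, hpj'⟩, if_pos rfl]
        · rw [if_neg, if_neg hjj]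
          rintro ⟨i, hri, hsi⟩
          have hij : i = j := by
            by_contra hne
            have hg := Nat.dvd_gcd hri hpj
            rw [(coprime_apply_of_mem_dkBox hrbox hne).gcd_eq_one] at hg
            exact hp.one_lt.ne' (Nat.dvd_one.1 hg)
          have hij' : i = j' := by
            by_contra hne
            have hg := Nat.dvd_gcd hsi hpj'
            rw [(coprime_apply_of_mem_dkBox hsbox hne).gcd_eq_one] at hg
            exact hp.one_lt.ne' (Nat.dvd_one.1 hg)
          exact hjj (hij.symm.trans hij')
      -- the other local factors are unchanged
      have hSq : ∀ q ∈ N.primeFactors.erase p,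
          localFactorM L m (Function.update r j (r j / p)) (Function.update s j' (s j' / p)) q =
            localFactorM L m r s q := by
        intro q hq
        obtain ⟨hqp, hqN⟩ := Finset.mem_erase.1 hq
        have hqprime := Nat.prime_of_mem_primeFactors hqN
        unfold localFactorM
        simp only [prime_dvd_update_div_iff r j hp hqprime hqp hpj,
          prime_dvd_update_div_iff s j' hp hqprime hqp hpj']
      rw [hSp, Finset.prod_congr rfl hSq]

end Literature.NumberTheory.Sieve.FGKMT2018
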